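import Summits.CriticalPhenomena.Ising3DConformalLimit.Theorems.MoebiusLimitExists.Negative.InversionContent

/-!
# `MoebiusLimit` (item stmt-CriticalPhenomena-1344): the lattice test of inversion covariance

Negative knowledge about the crux `…Theses.EnergyNotSigmaSquared.MoebiusLimit`
(= `PerfectScreening.MoebiusLimitExists`), standing crux disprover (D-0016); THEOREM-ONLY.
The one non-automatic clause of the crux — covariance of the limit under `x ↦ x/‖x‖²`
(`CruxReduced`, `InversionContent`, `RotationFromInversion`) — has a renormalisation-free lattice
shadow, the cheapest falsifier of the conformal content proper:

* `witness_four_point_inversion_ratio` — for every witness `(ρ, Δ, S)` and every non-coincident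
  quadruple `x` of `ℝ³` avoiding the origin,
  `⟨∏σ_{[ιxᵢ/δ]}⟩_{β_c} / ⟨∏σ_{[xᵢ/δ]}⟩_{β_c} → ∏ᵢ ‖xᵢ‖^{2Δ}` as `δ → 0⁺` (`ρ(δ)⁴` cancels; the
  denominator limit is `S₄(x) > 0` by GKS II in the limit);
* `covariantLimit_two_point_inversion_ratio` — the two-point analogue holds for ANY
  `O(3)`+scale-covariant non-degenerate limit (inversion covariance of `S₂` being automatic):
  `⟨σ_{[ιx/δ]}σ_{[ιy/δ]}⟩ / ⟨σ_{[x/δ]}σ_{[y/δ]}⟩ → (‖x‖‖y‖)^{2Δ}`.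
So a Monte-Carlo measurement of four-point ratios at inverted quadruples tests exactly the part of
the crux that no symmetry bookkeeping supplies.
-/

noncomputable section

namespace Summit.CriticalPhenomena.Ising3DConformalLimit.MoebiusLimitExistsNegative

open Literature.Probability.LatticeModels Filter Set EuclideanGeometry
open scoped Topology

variable {ρ : ℝ → ℝ} {Δ : ℝ} {S : CorrFamily 3}

/-- Ratios of raw correlators are ratios of rescaled correlators (the renormalisation cancels).
[folklore] -/
theorem ratio_eq_rescaled_ratio {n : ℕ} {δ : ℝ} (hρ : ρ δ ≠ 0)
    (x y : Fin n → EuclideanSpace ℝ (Fin 3)) :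
    criticalCorr 3 n (fun i => latticeApprox δ (x i)) / criticalCorr 3 n (fun i => latticeApprox δ (y i)) =
      rescaledCorrelator (criticalCorr 3) ρ n δ x / rescaledCorrelator (criticalCorr 3) ρ n δ y := by
  rw [rescaledCorrelator_apply, rescaledCorrelator_apply, mul_div_mul_left _ _ (pow_ne_zero n hρ)]

/-- **The four-point lattice test of inversion covariance.** For a witness of the crux (only
`ρ > 0`, the limit, non-degeneracy and inversion covariance are used) and a non-coincident quadruple
avoiding the origin: `⟨∏σ_{[ιxᵢ/δ]}⟩ / ⟨∏σ_{[xᵢ/δ]}⟩ → ∏‖xᵢ‖^{2Δ}`. [folklore] -/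
theorem witness_four_point_inversion_ratio (hρ : ∀ δ ∈ Set.Ioc (0:ℝ) 1, 0 < ρ δ)
    (hlim : HasPointwiseScalingLimit (criticalCorr 3) ρ S) (hnd : IsNondegenerateTwoPoint S)
    (hinv : IsInversionCovariant Δ S) {x : Fin 4 → EuclideanSpace ℝ (Fin 3)}
    (hx : x ∈ NonCoincident 3 4) (hx0 : ∀ i, x i ≠ 0) :
    Tendsto (fun δ => criticalCorr 3 4 (fun i => latticeApprox δ (inversion 0 1 (x i))) /
        criticalCorr 3 4 (fun i => latticeApprox δ (x i))) (𝓝[>] (0:ℝ))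
      (𝓝 (∏ i, ‖x i‖ ^ (2 * Δ))) := by
  have hιx : (fun i => inversion (0 : EuclideanSpace ℝ (Fin 3)) 1 (x i)) ∈ NonCoincident 3 4 := by
    rw [mem_nonCoincident] at hx ⊢
    exact (inversion_injective _ one_ne_zero).comp hx
  have hpos : 0 < S 4 x := limit_four_pos hlim hnd hx
  have h1 := (hlim 4).tendsto_at hιx
  have h2 := (hlim 4).tendsto_at hx
  rw [hinv 4 x hx0] at h1
  have h := h1.div h2 hpos.ne'
  rw [mul_div_assoc, div_self hpos.ne', mul_one] at h
  refine h.congr' ?_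
  filter_upwards [Ioc_mem_nhdsGT one_pos] with δ hδ
  exact (ratio_eq_rescaled_ratio (hρ δ hδ).ne' _ _).symm

/-- **The two-point lattice test holds for ANY `O(3)`+scale-covariant non-degenerate limit**
(inversion covariance of `S₂` is automatic, `InversionContent.inversion_two_of_covariantLimit`):
`⟨σ_{[ιx/δ]}σ_{[ιy/δ]}⟩ / ⟨σ_{[x/δ]}σ_{[y/δ]}⟩ → (‖x‖‖y‖)^{2Δ}`. [folklore] -/
theorem covariantLimit_two_point_inversion_ratio (hρ : ∀ δ ∈ Set.Ioc (0:ℝ) 1, 0 < ρ δ)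
    (hlim : HasPointwiseScalingLimit (criticalCorr 3) ρ S) (hnd : IsNondegenerateTwoPoint S)
    (hrot : IsRotationInvariant S) (hsc : IsScaleCovariant Δ S) {x : Fin 2 → EuclideanSpace ℝ (Fin 3)}
    (hx : x ∈ NonCoincident 3 2) (hx0 : ∀ i, x i ≠ 0) :
    Tendsto (fun δ => criticalCorr 3 2 (fun i => latticeApprox δ (inversion 0 1 (x i))) /
        criticalCorr 3 2 (fun i => latticeApprox δ (x i))) (𝓝[>] (0:ℝ))
      (𝓝 (∏ i, ‖x i‖ ^ (2 * Δ))) := by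
  have hιx : (fun i => inversion (0 : EuclideanSpace ℝ (Fin 3)) 1 (x i)) ∈ NonCoincident 3 2 := by
    rw [mem_nonCoincident] at hx ⊢
    exact (inversion_injective _ one_ne_zero).comp hx
  have hpos : 0 < S 2 x := hnd x hx
  have h1 := (hlim 2).tendsto_at hιx
  have h2 := (hlim 2).tendsto_at hx
  rw [inversion_two_of_covariantLimit hlim hrot hsc x hx0 hx] at h1
  have h := h1.div h2 hpos.ne'
  rw [mul_div_assoc, div_self hpos.ne', mul_one] at h
  refine h.congr' ?_
  filter_upwards [Ioc_mem_nhdsGT one_pos] with δ hδ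
  exact (ratio_eq_rescaled_ratio (hρ δ hδ).ne' _ _).symm

/-- **The crux predicts the four-point inversion ratios on `ℤ³`.** [folklore] -/
theorem moebiusLimit_implies_four_point_inversion_ratio
    (h : Summit.CriticalPhenomena.Ising3DConformalLimit.Theses.EnergyNotSigmaSquared.MoebiusLimit) :
    ∃ Δ : ℝ, Δ ∈ Set.Icc (1 / 2 : ℝ) (3 / 4) ∧ ∀ x : Fin 4 → EuclideanSpace ℝ (Fin 3),
      x ∈ NonCoincident 3 4 → (∀ i, x i ≠ 0) →
        Tendsto (fun δ => criticalCorr 3 4 (fun i => latticeApprox δ (inversion 0 1 (x i))) /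
            criticalCorr 3 4 (fun i => latticeApprox δ (x i))) (𝓝[>] (0:ℝ))
          (𝓝 (∏ i, ‖x i‖ ^ (2 * Δ))) := by
  obtain ⟨ρ, Δ, S, hρ, -, hlim, hnd, hM⟩ := h
  exact ⟨Δ, delta_mem_Icc_of_covariantLimit hρ hlim hnd hM.isEuclideanInvariant.2 hM.isScaleCovariant,
    fun x hx hx0 => witness_four_point_inversion_ratio hρ hlim hnd hM.isInversionCovariant hx hx0⟩

end Summit.CriticalPhenomena.Ising3DConformalLimit.MoebiusLimitExistsNegative

end
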